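import Literature.NumberTheory.EllipticCurves.Sprung2024.ChromaticRankZeroOneSided
import Literature.NumberTheory.EllipticCurves.Sprung2024.ChromaticRankOneOneSidedOfKato
import Literature.NumberTheory.EllipticCurves.PerrinRiou2003.RankZeroSupersingularUpperBound
import HarnessLib

/-!
# Sprung 2024 Cor. 1.2 (second sentence) ⇐ Perrin-Riou 2003 Prop. 4.8 (Kato), in the kernel:
# the rank-ZERO square-free-conductor binder rests on the registry's image-hypothesis chain

HONEST FRAMING (cross-ladder LITERATURE-TYPING layer D-0088(4), cell `bsd-littype`, seat
`bsd-littype-11`; theorems only, NO new named fact, nothing asserted about any curve): the sibling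
file `ChromaticRankZeroOneSided.lean` (this seat, p453950) vendors Sprung, Adv. Math. 449 (2024)
Cor. 1.2, second sentence, as the named fact `Sprung2024.cor12_padicValRat_bsd_rank_zero_le`
(`|L(E,1)/Ω|_p ⩽ |#Ш ∏c_l|_p` at an odd good supersingular `p`, square-free `N`, NO image
hypothesis). Exactly as the rank-ONE twin was reduced to the Kobayashi 2013 / Perrin-Riou 2003 chain
(`cor13_padicValRat_bsd_rank_one_le_of_rem13`, `ChromaticRankOneOneSidedOfKato.lean`, audit
`pub/bsd-cited/sheets/D-AUDIT-r18.md`), this file shows the rank-ZERO fact is IMPLIED by the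
registry's Perrin-Riou 2003 Prop. 4.8 binder `PerrinRiou2003.prop48_padicValRat_bsd_rank_zero_le`
(Kato's one-sided rank-`0` inequality under Kato's (12.5.2), ANY conductor): on Sprung's class the
image hypothesis is the tree THEOREM `imageContainsSL2_of_isSemistable_of_supersingular` (Serre
Prop. 12 → Prop. 21 i) → IV-23 / Wuthrich Lemma 20 — the kernel form of Sprung's own in-paper
discharge, p. 37 L57 – p. 38 L5: Fontaine irreducibility + Ribet level-lowering + Skinner's
relaxation), and the printed torsion-free right-hand side is the BSD-shaped one because
`ord_p #E(ℚ)_tors = 0` at a supersingular `p` (`padicValNat_torsionOrder_eq_zero_of_supersingular`).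
So the two rank-zero supersingular upper-bound binders rest on ONE printed chain (PR03 Prop. 4.8 ⇐
PR93 Thm. 3.1 + Kato Thm. 12.5 (4)) — priced once by the referee, not twice.

## References
* F. I. Sprung, Adv. Math. 449 (2024) 109741, Cor. 1.2 (p. 4), p. 5 L2–L6, pp. 37–38. [Sprung2024]
* B. Perrin-Riou, Experiment. Math. 12 (2003), Prop. 4.8 (p. 162). [PerrinRiou2003]
* K. Kato, Astérisque 295 (2004), Thm. 12.5 (4), (12.5.2). [Kato2004Asterisque]
-/

noncomputable section

open scoped Classical NumberField

open WeierstrassCurve Literature.NumberTheory.EllipticCurves.Rank1Residual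
  Literature.NumberTheory.EllipticCurves.Rank1Residual.Typed

namespace Literature.NumberTheory.EllipticCurves.Sprung2024

variable (W : WeierstrassCurve ℚ) [W.IsElliptic] [W.IsGloballyMinimal] (p : ℕ) [Fact p.Prime]

/-- **Sprung 2024 Cor. 1.2 (second sentence) ⇐ Perrin-Riou 2003 Prop. 4.8**, in the kernel:
granted `PerrinRiou2003.prop48_padicValRat_bsd_rank_zero_le` (one-sided `p`-part of BSD in analytic
rank `0` at an odd good supersingular `p` under Kato's (12.5.2), any conductor), the
square-free-conductor statement `Sprung2024.cor12_padicValRat_bsd_rank_zero_le` follows: the image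
hypothesis is `imageContainsSL2_of_isSemistable_of_supersingular`, and the torsion term vanishes
(`padicValNat_torsionOrder_eq_zero_of_supersingular`).
[cite: Sprung2024, Cor. 1.2 (p. 4), second sentence; pp. 37–38 (image hypothesis)] [cite: PerrinRiou2003, Prop. 4.8 (p. 162)] -/
theorem cor12_padicValRat_bsd_rank_zero_le_of_prop48
    (h : PerrinRiou2003.prop48_padicValRat_bsd_rank_zero_le) :
    cor12_padicValRat_bsd_rank_zero_le := by
  intro W _ _ p _ hp hsst hgood hss hL hfin
  obtain ⟨q, hq, hv⟩ := h W p hp hgood hss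
    (imageContainsSL2_of_isSemistable_of_supersingular W p hp hsst hgood hss) hL hfin
  exact ⟨q, hq, (cor12_iff_torsionForm W p hp hgood hss q).mpr hv⟩

/-- **Bookkeeping corollary**: on a semistable curve the typed UPPER bound at an odd good
supersingular prime in analytic rank `0` (`MissingUpperBoundAt W p`) follows from the Perrin-Riou /
Kato binder alone — consumers of `cor12_…` can be fed `hPR` through
`cor12_padicValRat_bsd_rank_zero_le_of_prop48`. [cite: PerrinRiou2003, Prop. 4.8 (p. 162)]
[cite: Sprung2024, Cor. 1.2 (p. 4), second sentence] [cite: Miller2011LMS, Def. 1.1] -/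
theorem missingUpperBoundAt_of_prop48_of_semistable
    (h : PerrinRiou2003.prop48_padicValRat_bsd_rank_zero_le)
    (hGZK : rank_eq_analyticRank_of_analyticRank_le_one)
    (hmod : hasEntireLFunction_rat) (hp : p ≠ 2) (hsst : Semistable W)
    (hss : GoodSS W p) (hr : W.analyticRank = 0) : MissingUpperBoundAt W p :=
  missingUpperBoundAt_of_cor12 W p (cor12_padicValRat_bsd_rank_zero_le_of_prop48 h) hGZK hmod hp hsst
    hss hr

end Literature.NumberTheory.EllipticCurves.Sprung2024

end
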